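import Literature.MathematicalPhysics.QuantumLattice.HubbardTTPrimeGrandCanonicalThermalStatesKMSRows
import Literature.MathematicalPhysics.QuantumLattice.HubbardTTPrimeGrandCanonicalThermalStates
import Literature.MathematicalPhysics.QuantumLattice.TorusSectorGibbsEntropyRowLimit
import Literature.MathematicalPhysics.QuantumLattice.FermionGateDressingLightCone
import Literature.MathematicalPhysics.QuantumLattice.HubbardTorusTTPrimeMarkovPressureClusterBound
import HarnessLib

/-!
# The entropy row of thermal grand-canonical states of the 2D `t–t'` Hubbard model:
# `P(β;μ,h) + β u(ω) ≤ (Re ω_B(G) + log Tr e^{−G})/|B|` for every box `B` and every witness `G`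

Family `hubbard` (topic `MathematicalPhysics/QuantumLattice`). The grand-canonical companion of
`TorusSectorGibbsDensity` / `TorusSectorGibbsEntropyRow{,Limit}` (the «ent» row of CANONICAL torus limits, keyed to
`E₀`/`e(n)`), completing the row families of `HubbardTTPrimeGrandCanonicalThermalStatesKMSRows` / `…BogoliubovRows` /
`…KMSMomentRows` for the grand-canonical class with the one THERMODYNAMIC row — the one that carries the pressure
NUMBER `P = gcPressureTT'Zeeman β t t' U μ h` into a state relaxation:

* §1 `gcGibbsDensityTT' L β t t' U μ h = e^{−βK_L}/tr e^{−βK_L}` as a MATRIX (`K_L = gcTorusHamiltonianTT'`): it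
  represents the Gibbs state / the eigen-mixture (`trace_gcGibbsDensityTT'_mul(_eq_gibbsState)`), is a density matrix,
  is EVEN (`parityAut_gcGibbsDensityTT'`: `e^{−βK_L}` commutes with `N`) and TRANSLATION INVARIANT
  (`relabel_translate_gcGibbsDensityTT'`: the translations commute with `K_L` and are unitary), and
  **`S(ρ_{L,β}) = log Re Ξ_L + β Σ_i p_{L,i} Re⟨ψ_{L,i}, K_L ψ_{L,i}⟩`** exactly (`vonNeumannEntropy_gcGibbsDensityTT'`).
* §2 `tr(ρ_{L,β} Γ_B G) = Σ_i p_{L,i} torusAvgExpectAt L B G ψ_{L,i}` (translation invariance of traces).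
* §3 the FINITE-VOLUME ROW (every real `β`; rectangle `B = ∏[0,m_i)`, Hermitian witness `G ∈ 𝔄_B`):
  `log Re Ξ_L + β⟨K_L⟩ ≤ N_L·(Σ_i p_{L,i} Re avg_B(G) + log Re Tr e^{−G}) + (L² − N_L|B|)·log 4`
  (`gcGibbs_log_partitionFn_add_energy_le_box`: `S = log Ξ + β⟨K⟩`, box subadditivity
  `torus_vonNeumannEntropy_le_card_mul_box` for the even TI density, Klein on the box).
* §4 THE ROW IN THE LIMIT (`β ≥ 0`, `U ≥ 0`; `ω` thermal grand-canonical along `Ls → ∞`; `m_i > 0`):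

    `P(β; t,t',U; μ,h) + β·u(ω) ≤ (Re ω_B(G) + log Re Tr e^{−G}) / ∏ m_i`,  `u(ω) = e_Φ(ω) − μρ(ω) − h m(ω)`

  (`IsTorusLimitOfMixture.gcPressureTT'Zeeman_add_mul_energy_le_of_gcGibbs_box`; zero-field form
  `…gcPressureTT'_add_mul_energy_le_of_gcGibbs_box`): minimising over `G` the right-hand side is the local entropy
  `S(ω_B)/|B|`, so the row says `s_B(ω) ≥ P + βu(ω)` — the entropy density of the thermal state from below, in the linear
  form a relaxation reads (`|B|(W + βu(ω)) − log Tr e^{−G} ≤ Re ω_B(G)` once `W ≤ P` is certified).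

One definition with body (`gcGibbsDensityTT'`); everything else PROVED; no named fact, no sorry, no instance. The four
declarations with long `rw`/`exp`/`field_simp` chains carry `maxHeartbeats 400000` (measured > 60000 at the default's
third). WHAT THIS IS NOT: the converse Gibbs variational inequality for arbitrary states (that is the pressure's
definition side, `gcPressureTT'Zeeman_le_of_eventually`); a number of record.

## Mathlib / tree search

`lean search 'gcGibbsDensity|entropy.*gcGibbs'`: nothing (2026-08-27). REUSED: `trace_gibbsDensity(_mul)`,
`IsHermitian.posSemidef_gibbsDensity`, `IsHermitian.vonNeumannEntropy_gibbsDensity`, `gibbsEntropy_def`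
(`GibbsVariationalPrinciple`, `GibbsEntropy`), `parityAut_eq_self_of_commute_totalNumber` (`FermionGateDressingLightCone`),
`Commute.exp_right/_left`, `relabel_translate_hubbardTorusTT'_sub_mu` (`HubbardTorusTTPrimeMarkovPressureClusterBound`),
`relabel_translate_numberOp`, `relabel_eq_fockRelabel_conj`, `fockTranslate_val_conjTranspose_eq_neg`,
`fockTranslate_val_(conjTranspose_)mul_val_(conjTranspose_)mul`, `Matrix.ext_iff_trace_mul_right`, `trace_relabel`,
`relabel_symm_relabel`, `expect_sum_relabel_translate_fermionEmbed'`, `torus_vonNeumannEntropy_le_card_mul_box`,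
`vonNeumannEntropy_fermionPartialTrace_le_re_trace_mul_add`, `injOn_proj_halfOpenRect`, `tendsto_card_rectTilingVecs_div_sq`
(`TorusSectorGibbsEntropyRow{,Limit}`), `numberAt_commute`, `hubbardTorusTT'_commute_totalNumber`,
`fockTranslate_commute_gcTorusHamiltonianTT'`, `tendsto_log_partitionFn_gcTorus_div_sq_comp`,
`IsTorusLimitOfMixture.tendsto_sum_mul_re_expect_gcTorusHamiltonianTT'_div_sq`.

## References

* R. B. Israel, *Convexity in the Theory of Lattice Gases* (1979), Lemma II.3.1 (Gibbs variational principle /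
  Klein), §I.3 eq. (26). [cite: Israel1979, Lemma II.3.1]
* H. Araki, H. Moriya, Rev. Math. Phys. 15 (2003) 93, Thm. 3.8 and §10 (strong subadditivity for even CAR states),
  §4.1 Def. 4.5. [cite: ArakiMoriya2003, Theorem 3.8 and §10]
* O. Bratteli, D. W. Robinson, *Operator Algebras and Quantum Statistical Mechanics II* (1997), §5.3.1.
  [cite: BratteliRobinsonII1997, §5.3.1]
* E. H. Lieb, Phys. Rev. Lett. 62 (1989) 1201, eqs. (1)–(2). [cite: LiebPRL1989, eqs. (1)–(2)]
* H. Xu et al., Science 384 (2024) eadh7691, eq. (1). [cite: XuEtAl2024, eq. (1)]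
-/

noncomputable section

namespace Literature.MathematicalPhysics.QuantumLattice

open Matrix Finset HubbardWave0 Literature.Probability.LatticeModels ThermodynamicLimit LiebThm1
open Literature.InformationTheory.Entropy (vonNeumannEntropy)
open _root_.Filter
open scoped _root_.Topology ComplexOrder BigOperators

/-! ### §1 The grand-canonical Gibbs DENSITY MATRIX of the torus: even, translation invariant, `S = log Ξ + β⟨K⟩` -/

section Density

variable (L : ℕ) (β t t' U μ hz : ℝ)

/-- **The grand-canonical Gibbs density matrix** `ρ_{L,β} = e^{−βK_L} / tr e^{−βK_L}` of
`K_L = gcTorusHamiltonianTT' L t t' U μ h` on the whole Fock space of the `L × L` torus.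
[cite: Israel1979, §I.3 eq. (26)] -/
def gcGibbsDensityTT' : Matrix (Finset (Orb (FermionTorus 2 L))) (Finset (Orb (FermionTorus 2 L))) ℂ :=
  (partitionFn β (gcTorusHamiltonianTT' L t t' U μ hz))⁻¹ • gibbsWeight β (gcTorusHamiltonianTT' L t t' U μ hz)

/-- `ρ_{L,β}` represents the Gibbs state: `tr(ρ_{L,β} Y) = gibbsState β K_L Y` for every `Y`.
[cite: Israel1979, §I.3 eq. (26)] -/
theorem trace_gcGibbsDensityTT'_mul_eq_gibbsState
    (Y : Matrix (Finset (Orb (FermionTorus 2 L))) (Finset (Orb (FermionTorus 2 L))) ℂ) :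
    (gcGibbsDensityTT' L β t t' U μ hz * Y).trace = gibbsState β (gcTorusHamiltonianTT' L t t' U μ hz) Y := by
  rw [gcGibbsDensityTT', trace_gibbsDensity_mul]

/-- **`ρ_{L,β}` is the eigen-mixture**: `tr(ρ_{L,β} Y) = Σ_i p_{L,i}(β) ⟨ψ_{L,i}, Y ψ_{L,i}⟩` for every `Y`.
[cite: Israel1979, §I.3 eq. (26)] -/
theorem trace_gcGibbsDensityTT'_mul (Y : Matrix (Finset (Orb (FermionTorus 2 L))) (Finset (Orb (FermionTorus 2 L))) ℂ) :
    (gcGibbsDensityTT' L β t t' U μ hz * Y).trace =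
      ∑ i, (gcGibbsWeightTT' β t t' U μ hz L i : ℂ) * expect Y (gcGibbsVectorTT' t t' U μ hz L i) := by
  rw [trace_gcGibbsDensityTT'_mul_eq_gibbsState, sum_gcGibbsWeightTT'_mul_expect_eq_gibbsState]

/-- Real form: `Re tr(ρ_{L,β} Y) = Σ_i p_{L,i} Re⟨ψ_{L,i}, Y ψ_{L,i}⟩`. [cite: Israel1979, §I.3 eq. (26)] -/
theorem re_trace_gcGibbsDensityTT'_mul (Y : Matrix (Finset (Orb (FermionTorus 2 L))) (Finset (Orb (FermionTorus 2 L))) ℂ) :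
    (gcGibbsDensityTT' L β t t' U μ hz * Y).trace.re =
      ∑ i, gcGibbsWeightTT' β t t' U μ hz L i * (expect Y (gcGibbsVectorTT' t t' U μ hz L i)).re := by
  rw [trace_gcGibbsDensityTT'_mul, Complex.re_sum]
  refine Finset.sum_congr rfl fun i _ => ?_
  rw [Complex.re_ofReal_mul]

/-- `ρ_{L,β}` is positive semidefinite. [cite: BratteliRobinsonII1997, §5.3.1] -/
theorem posSemidef_gcGibbsDensityTT' : (gcGibbsDensityTT' L β t t' U μ hz).PosSemidef :=
  (gcTorusHamiltonianTT'_isHermitian L t t' U μ hz).posSemidef_gibbsDensity β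

/-- `tr ρ_{L,β} = 1`. [cite: BratteliRobinsonII1997, §5.3.1] -/
theorem trace_gcGibbsDensityTT' : (gcGibbsDensityTT' L β t t' U μ hz).trace = 1 :=
  trace_gibbsDensity β _ (partitionFn_pos β (gcTorusHamiltonianTT'_isHermitian L t t' U μ hz)).ne'

/-- `K_L` commutes with the particle number. [cite: LiebPRL1989, eqs. (1)–(2)] -/
theorem commute_totalNumber_gcTorusHamiltonianTT' :
    Commute (totalNumber : Matrix (Finset (Orb (FermionTorus 2 L))) (Finset (Orb (FermionTorus 2 L))) ℂ)
      (gcTorusHamiltonianTT' L t t' U μ hz) := by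
  have hnn : ∀ (a b : FermionTorus 2 L) (σ τ : Fin 2), Commute (numberOp a σ) (numberOp b τ) :=
    fun a b σ τ => numberAt_commute (orb a σ) (orb b τ)
  have hNM : Commute (totalNumber : Matrix (Finset (Orb (FermionTorus 2 L))) (Finset (Orb (FermionTorus 2 L))) ℂ)
      spinImbalance := by
    rw [totalNumber, spinImbalance]
    refine Commute.sum_left _ _ _ fun a _ => Commute.sum_left _ _ _ fun σ _ =>
      Commute.sum_right _ _ _ fun b _ => (hnn a b σ 0).sub_right (hnn a b σ 1)
  rw [gcTorusHamiltonianTT']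
  exact ((hubbardTorusTT'_commute_totalNumber L t t' U).symm.sub_right
    ((Commute.refl _).smul_right _)).sub_right (hNM.smul_right _)

/-- **`ρ_{L,β}` is EVEN**: `Θ ρ_{L,β} = ρ_{L,β}` (`e^{−βK_L}` commutes with `N`). [cite: ArakiMoriya2003, §4.1 Def. 4.5] -/
theorem parityAut_gcGibbsDensityTT' :
    parityAut (gcGibbsDensityTT' L β t t' U μ hz) = gcGibbsDensityTT' L β t t' U μ hz := by
  refine parityAut_eq_self_of_commute_totalNumber ?_
  have h1 : Commute (totalNumber : Matrix (Finset (Orb (FermionTorus 2 L))) (Finset (Orb (FermionTorus 2 L))) ℂ)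
      (-(β : ℂ) • gcTorusHamiltonianTT' L t t' U μ hz) :=
    (commute_totalNumber_gcTorusHamiltonianTT' L t t' U μ hz).smul_right _
  have h2 : Commute (totalNumber : Matrix (Finset (Orb (FermionTorus 2 L))) (Finset (Orb (FermionTorus 2 L))) ℂ)
      (gibbsWeight β (gcTorusHamiltonianTT' L t t' U μ hz)) := h1.exp_right
  rw [gcGibbsDensityTT']
  exact h2.smul_right _

variable [NeZero L]

/-- The spin numbers are translation invariant on the torus: `Γ(τ_w) N_σ = N_σ`. [folklore] -/
private theorem relabel_translate_spinNumber' (w : TorusSite 2 L) (σ : Fin 2) :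
    relabel (Orb.translate w) (∑ a : FermionTorus 2 L, numberOp a σ) = ∑ a : FermionTorus 2 L, numberOp a σ := by
  rw [relabel_sum]
  have h1 : ∑ a : FermionTorus 2 L, relabel (Orb.translate w) (numberOp a σ) =
      ∑ x : TorusSite 2 L, numberOp (FermionTorus.ofTorusSite (x + w)) σ := by
    refine (Fintype.sum_equiv FermionTorus.equivTorusSite _ _ fun a => ?_)
    rw [← relabel_translate_numberOp]
    congr 2
    exact (FermionTorus.ofTorusSite_toTorusSite a).symm
  rw [h1]
  exact Fintype.sum_equiv ((Equiv.addRight w).trans FermionTorus.equivTorusSite.symm) _ _ fun x => rfl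

set_option maxHeartbeats 400000 in
/-- **`K_L` is translation invariant**: `Γ(τ_w) K_L = K_L`. [cite: XuEtAl2024, eq. (1)] -/
theorem relabel_translate_gcTorusHamiltonianTT' (w : TorusSite 2 L) :
    relabel (Orb.translate w) (gcTorusHamiltonianTT' L t t' U μ hz) = gcTorusHamiltonianTT' L t t' U μ hz := by
  have hM : relabel (Orb.translate w)
      (spinImbalance : Matrix (Finset (Orb (FermionTorus 2 L))) (Finset (Orb (FermionTorus 2 L))) ℂ) = spinImbalance := by
    rw [spinImbalance_eq_spinNumber_sub_spinNumber, relabel_sub, relabel_translate_spinNumber',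
      relabel_translate_spinNumber']
  rw [gcTorusHamiltonianTT', relabel_sub, relabel_smul, relabel_translate_hubbardTorusTT'_sub_mu, hM]

set_option maxHeartbeats 400000 in
/-- **`ρ_{L,β}` is TRANSLATION INVARIANT**: `Γ(τ_w) ρ_{L,β} = ρ_{L,β}` (`e^{−βΓK} = Γe^{−βK}`, `Tr` invariant).
[cite: ArakiMoriya2003, §4.1 Def. 4.5] -/
theorem relabel_translate_gcGibbsDensityTT' (w : TorusSite 2 L) :
    relabel (Orb.translate w) (gcGibbsDensityTT' L β t t' U μ hz) = gcGibbsDensityTT' L β t t' U μ hz := by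
  set K := gcTorusHamiltonianTT' L t t' U μ hz with hKdef
  refine Matrix.ext_iff_trace_mul_right.2 fun Y => ?_
  have hU : (fockTranslate w).valᴴ = (fockTranslate (-w)).val := fockTranslate_val_conjTranspose_eq_neg L w
  have hconj : (fockTranslate w).valᴴ * Y * (fockTranslate w).val = relabel (Orb.translate (-w)) Y := by
    rw [relabel_eq_fockRelabel_conj]
    change _ = (fockTranslate (-w)).val * Y * (fockTranslate (-w)).valᴴ
    rw [← hU, Matrix.conjTranspose_conjTranspose]
  -- invariance of the Gibbs state under the translation `U_w` (commutes with `K_L`, unitary)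
  have hinv : gibbsState β K ((fockTranslate w).valᴴ * Y * (fockTranslate w).val) = gibbsState β K Y := by
    have hc : Commute (gibbsWeight β K) (fockTranslate w).valᴴ := by
      have h0 : Commute (fockTranslate w).valᴴ K := by
        have h := fockTranslate_commute_gcTorusHamiltonianTT' L t t' U μ hz w
        have hKh : Kᴴ = K := gcTorusHamiltonianTT'_isHermitian L t t' U μ hz
        have h2 := congrArg Matrix.conjTranspose h.eq
        rw [conjTranspose_mul, conjTranspose_mul, hKh] at h2
        exact h2.symm
      have h1 : Commute (-(β : ℂ) • K) (fockTranslate w).valᴴ := (h0.symm).smul_left _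
      exact h1.exp_left
    have hUU : (fockTranslate w).val * (fockTranslate w).valᴴ = 1 := by
      have h := fockTranslate_val_mul_val_conjTranspose_mul L w 1
      rwa [Matrix.mul_one] at h
    rw [gibbsState_apply, gibbsState_apply]
    congr 1
    calc (gibbsWeight β K * ((fockTranslate w).valᴴ * Y * (fockTranslate w).val)).trace
        = ((fockTranslate w).valᴴ * (gibbsWeight β K * Y) * (fockTranslate w).val).trace := by
          rw [← Matrix.mul_assoc, ← Matrix.mul_assoc, hc.eq, Matrix.mul_assoc (fockTranslate w).valᴴ]
      _ = ((fockTranslate w).val * (fockTranslate w).valᴴ * (gibbsWeight β K * Y)).trace := by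
          rw [trace_mul_cycle, Matrix.mul_assoc]
      _ = (gibbsWeight β K * Y).trace := by rw [hUU, Matrix.one_mul]
  calc (relabel (Orb.translate w) (gcGibbsDensityTT' L β t t' U μ hz) * Y).trace
      = ((fockTranslate w).val * (gcGibbsDensityTT' L β t t' U μ hz * (fockTranslate w).valᴴ * Y)).trace := by
        rw [relabel_eq_fockRelabel_conj]
        simp only [Matrix.mul_assoc]
    _ = (gcGibbsDensityTT' L β t t' U μ hz * ((fockTranslate w).valᴴ * Y * (fockTranslate w).val)).trace := by
        rw [Matrix.trace_mul_comm]
        simp only [Matrix.mul_assoc]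
    _ = gibbsState β K ((fockTranslate w).valᴴ * Y * (fockTranslate w).val) :=
        trace_gcGibbsDensityTT'_mul_eq_gibbsState L β t t' U μ hz _
    _ = gibbsState β K Y := hinv
    _ = (gcGibbsDensityTT' L β t t' U μ hz * Y).trace := (trace_gcGibbsDensityTT'_mul_eq_gibbsState L β t t' U μ hz Y).symm

omit [NeZero L] in
/-- **`S(ρ_{L,β}) = log Ξ_L + β Re⟨K_L⟩_β`** — the entropy of the grand-canonical Gibbs state is the logarithm of
the grand-canonical partition function plus `β` times the `K`-energy (exact identity, every real `β`).
[cite: Israel1979, Lemma II.3.1] -/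
theorem vonNeumannEntropy_gcGibbsDensityTT' :
    vonNeumannEntropy (gcGibbsDensityTT' L β t t' U μ hz) =
      Real.log (partitionFn β (gcTorusHamiltonianTT' L t t' U μ hz)).re +
        β * ∑ i, gcGibbsWeightTT' β t t' U μ hz L i *
          (expect (gcTorusHamiltonianTT' L t t' U μ hz) (gcGibbsVectorTT' t t' U μ hz L i)).re := by
  rw [gcGibbsDensityTT', (gcTorusHamiltonianTT'_isHermitian L t t' U μ hz).vonNeumannEntropy_gibbsDensity β,
    gibbsEntropy_def, sum_gcGibbsWeightTT'_mul_re_expect_eq]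

end Density

/-! ### §2 Traces of pulled-back local observables are the mixture torus averages -/

section Traces

variable (L : ℕ) [NeZero L] (β t t' U μ hz : ℝ)

/-- **Translation invariance of traces**: `tr(ρ_{L,β} · Γ(τ_v) X) = tr(ρ_{L,β} · X)`. [cite: ArakiMoriya2003, §4.1 Def. 4.5] -/
theorem trace_gcGibbsDensityTT'_mul_relabel_translate (v : TorusSite 2 L)
    (X : Matrix (Finset (Orb (FermionTorus 2 L))) (Finset (Orb (FermionTorus 2 L))) ℂ) :
    (gcGibbsDensityTT' L β t t' U μ hz * relabel (Orb.translate v) X).trace =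
      (gcGibbsDensityTT' L β t t' U μ hz * X).trace := by
  set π : Equiv.Perm (Orb (FermionTorus 2 L)) := Orb.translate v with hπ
  have hinv : relabel π.symm (gcGibbsDensityTT' L β t t' U μ hz) = gcGibbsDensityTT' L β t t' U μ hz := by
    have h : π.symm = Orb.translate (-v) := by rw [hπ, Orb.translate_neg, Equiv.Perm.inv_def]
    rw [h]
    exact relabel_translate_gcGibbsDensityTT' L β t t' U μ hz (-v)
  calc (gcGibbsDensityTT' L β t t' U μ hz * relabel π X).trace
      = (relabel π.symm (gcGibbsDensityTT' L β t t' U μ hz * relabel π X)).trace := (trace_relabel _ _).symm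
    _ = (gcGibbsDensityTT' L β t t' U μ hz * X).trace := by rw [relabel_mul, relabel_symm_relabel, hinv]

/-- **The expectation of a pulled-back local observable is the mixture torus average**:
`tr(ρ_{L,β} · Γ_{B ↪ torus}(G)) = Σ_i p_{L,i}(β) · torusAvgExpectAt L B G ψ_{L,i}` — the quantity whose limit along
`Ls → ∞` defines `ω_B(G)` for a torus limit `ω`. [cite: Israel1979, §I.3 eq. (26)] -/
theorem trace_gcGibbsDensityTT'_mul_fermionEmbed_toTorusEmb {B : Finset (Site 2)}
    (hB : Set.InjOn (Torus.proj (d := 2) L) ↑B) (G : FermionOp B) :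
    (gcGibbsDensityTT' L β t t' U μ hz * fermionEmbed (PolySite.toTorusEmb L hB) G).trace =
      ∑ i, (gcGibbsWeightTT' β t t' U μ hz L i : ℂ) * torusAvgExpectAt L B G (gcGibbsVectorTT' t t' U μ hz L i) := by
  set ρ := gcGibbsDensityTT' L β t t' U μ hz with hρ
  have hL : ((L : ℂ)) ^ 2 ≠ 0 := pow_ne_zero _ (Nat.cast_ne_zero.2 (NeZero.ne L))
  have h1 : (ρ * ∑ v : TorusSite 2 L, relabel (Orb.translate v) (fermionEmbed (PolySite.toTorusEmb L hB) G)).trace =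
      ((L : ℂ)) ^ 2 * (ρ * fermionEmbed (PolySite.toTorusEmb L hB) G).trace := by
    rw [Matrix.mul_sum, Matrix.trace_sum]
    simp_rw [hρ, trace_gcGibbsDensityTT'_mul_relabel_translate]
    rw [Finset.sum_const, Finset.card_univ, nsmul_eq_mul]
    congr 1
    have : Fintype.card (TorusSite 2 L) = L ^ 2 := by simp [ZMod.card, Fintype.card_fin]
    rw [this]
    push_cast
    rfl
  have h2 : (ρ * ∑ v : TorusSite 2 L, relabel (Orb.translate v) (fermionEmbed (PolySite.toTorusEmb L hB) G)).trace =
      ((L : ℂ)) ^ 2 * ∑ i, (gcGibbsWeightTT' β t t' U μ hz L i : ℂ) *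
        torusAvgExpectAt L B G (gcGibbsVectorTT' t t' U μ hz L i) := by
    rw [hρ, trace_gcGibbsDensityTT'_mul, Finset.mul_sum]
    refine Finset.sum_congr rfl fun i _ => ?_
    rw [expect_sum_relabel_translate_fermionEmbed' L hB G]
    ring
  exact mul_left_cancel₀ hL (h1.symm.trans h2)

/-- Real form: `Re tr(Γ_{B ↪ torus}(G) · ρ_{L,β}) = Σ_i p_{L,i} Re torusAvgExpectAt L B G ψ_{L,i}`.
[cite: Israel1979, §I.3 eq. (26)] -/
theorem re_trace_fermionEmbed_toTorusEmb_mul_gcGibbsDensityTT' {B : Finset (Site 2)}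
    (hB : Set.InjOn (Torus.proj (d := 2) L) ↑B) (G : FermionOp B) :
    (fermionEmbed (PolySite.toTorusEmb L hB) G * gcGibbsDensityTT' L β t t' U μ hz).trace.re =
      ∑ i, gcGibbsWeightTT' β t t' U μ hz L i * (torusAvgExpectAt L B G (gcGibbsVectorTT' t t' U μ hz L i)).re := by
  rw [Matrix.trace_mul_comm, trace_gcGibbsDensityTT'_mul_fermionEmbed_toTorusEmb, Complex.re_sum]
  refine Finset.sum_congr rfl fun i _ => ?_
  rw [Complex.re_ofReal_mul]

end Traces

/-! ### §3 The finite-volume entropy row of the grand-canonical Gibbs state -/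

section Row

variable (L : ℕ) [NeZero L] (β t t' U μ hz : ℝ)

set_option maxHeartbeats 400000 in
/-- **Finite-volume entropy row of the grand-canonical Gibbs state** (every real `β`): for a rectangle
`B = ∏_i [0,m_i)` with `m_i ≤ L` and a Hermitian witness `G ∈ 𝔄_B`,
`log Re Ξ_L + β Σ_i p_{L,i} Re⟨ψ_{L,i}, K_L ψ_{L,i}⟩ ≤ N_L · (Σ_i p_{L,i} Re torusAvgExpectAt L B G ψ_{L,i} + log Re Tr e^{−G}) + (L² − N_L·∏m_i)·log 4`
(`S(ρ_{L,β}) = log Ξ_L + β⟨K_L⟩`, box subadditivity for the even translation-invariant density, Klein on the box).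
[cite: Israel1979, Lemma II.3.1] [cite: ArakiMoriya2003, Theorem 3.8 and §10] -/
theorem gcGibbs_log_partitionFn_add_energy_le_box {m : Fin 2 → ℕ} (hmL : ∀ i, m i ≤ L)
    {G : FermionOp (halfOpenRect m)} (hG : G.IsHermitian) :
    Real.log (partitionFn β (gcTorusHamiltonianTT' L t t' U μ hz)).re +
        β * ∑ i, gcGibbsWeightTT' β t t' U μ hz L i *
          (expect (gcTorusHamiltonianTT' L t t' U μ hz) (gcGibbsVectorTT' t t' U μ hz L i)).re ≤
      (#(rectTilingVecs m L) : ℝ) *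
          (∑ i, gcGibbsWeightTT' β t t' U μ hz L i *
              (torusAvgExpectAt L (halfOpenRect m) G (gcGibbsVectorTT' t t' U μ hz L i)).re +
            Real.log (partitionFn 1 G).re) +
        ((L : ℝ) ^ 2 - (#(rectTilingVecs m L) : ℝ) * (∏ i, (m i : ℝ))) * Real.log 4 := by
  set ρ := gcGibbsDensityTT' L β t t' U μ hz with hρ
  have hρpsd : ρ.PosSemidef := posSemidef_gcGibbsDensityTT' L β t t' U μ hz
  have hρtr : ρ.trace = 1 := trace_gcGibbsDensityTT' L β t t' U μ hz
  have h1 := vonNeumannEntropy_gcGibbsDensityTT' L β t t' U μ hz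
  have h2 := torus_vonNeumannEntropy_le_card_mul_box L hρpsd hρtr (parityAut_gcGibbsDensityTT' L β t t' U μ hz)
    (relabel_translate_gcGibbsDensityTT' L β t t' U μ hz) hmL
  have h3 := vonNeumannEntropy_fermionPartialTrace_le_re_trace_mul_add
    (PolySite.toTorusEmb L (injOn_proj_halfOpenRect L hmL)) hρpsd hρtr hG
  rw [re_trace_fermionEmbed_toTorusEmb_mul_gcGibbsDensityTT'] at h3
  have hN : (0 : ℝ) ≤ (#(rectTilingVecs m L) : ℝ) := Nat.cast_nonneg _
  have h4 := mul_le_mul_of_nonneg_left h3 hN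
  rw [← hρ] at h1
  linarith

end Row

/-! ### §4 The entropy row of thermal grand-canonical states -/

namespace InfVolFermionState

variable {β : ℝ} (hβ : 0 ≤ β) (t t' : ℝ) {U : ℝ} (hU : 0 ≤ U) (μ hz : ℝ)
  {ω : InfVolFermionState 2} {Ls : ℕ → ℕ}
include hβ hU

set_option maxHeartbeats 400000 in
/-- **THE ENTROPY ROW OF THERMAL GRAND-CANONICAL STATES.** Let `ω` be a torus limit of the grand-canonical
Gibbs states of `K_L(t,t',U,μ,h)` along `Ls → ∞` (`β ≥ 0`, `U ≥ 0`). Then for every rectangle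
`B = ∏_i [0,m_i)` (`m_i > 0`) and every Hermitian witness `G ∈ 𝔄_B`:

  `P(β; t,t',U; μ,h) + β·u(ω) ≤ (Re ω_B(G) + log Re Tr e^{−G}) / |B|`,

`u(ω) = e_{Φ(t,t',U)}(ω) − μρ(ω) − h m(ω)`, `|B| = ∏ m_i` — i.e. the Klein upper bound of the local entropy of
`ω` on `B` with ANY witness dominates `|B|·(P + βu(ω))` (the entropy density `s = P + βu` of the thermal state;
row family `ent` of the `T > 0` certificates, now for the grand-canonical class: with a certified floor
`W ≤ P` it is the linear row `|B|·(W + βu(ω)) − log Tr e^{−G} ≤ Re ω_B(G)`).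
[cite: Israel1979, Lemma II.3.1] [cite: ArakiMoriya2003, Theorem 3.8 and §10] -/
theorem IsTorusLimitOfMixture.gcPressureTT'Zeeman_add_mul_energy_le_of_gcGibbs_box
    (hω : ω.IsTorusLimitOfMixture sourcedGibbsCount (gcGibbsWeightTT' β t t' U μ hz)
      (gcGibbsVectorTT' t t' U μ hz) Ls)
    (hLs : Tendsto Ls atTop atTop) {m : Fin 2 → ℕ} (hm : ∀ i, 0 < m i)
    {G : FermionOp (halfOpenRect m)} (hG : G.IsHermitian) :
    gcPressureTT'Zeeman β t t' U μ hz +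
        β * (ω.meanEnergy (hubbardTTPrimeFermionInteraction t t' U) 1 - μ * ω.density -
          hz * ((ω.expect ({0} : Finset (Site 2)) (nAt 0 (Finset.mem_singleton_self 0) 0)).re -
            (ω.expect ({0} : Finset (Site 2)) (nAt 0 (Finset.mem_singleton_self 0) 1)).re)) ≤
      ((ω.expect (halfOpenRect m) G).re + Real.log (partitionFn 1 G).re) / ∏ i, (m i : ℝ) := by
  set P : ℝ := ∏ i, (m i : ℝ) with hPdef
  have hP : 0 < P := Finset.prod_pos fun i _ => by exact_mod_cast hm i
  set lz : ℝ := Real.log (partitionFn 1 G).re with hlz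
  -- the left-hand side: `log Ξ/L² + β Σ w Re⟨K⟩/L² → P(β;x) + β u(ω)`
  have hΞ := tendsto_log_partitionFn_gcTorus_div_sq_comp hβ t t' hU μ hz hLs
  have hK := hω.tendsto_sum_mul_re_expect_gcTorusHamiltonianTT'_div_sq hLs t t' U μ hz
  -- the right-hand side: `(N_L/L²)(Σ w Re avg G + lz) + (1 − N_L P/L²) log 4 → (Re ω_B(G) + lz)/P + 0`
  have hN := (tendsto_card_rectTilingVecs_div_sq hm).comp hLs
  have hG' := (Complex.continuous_re.tendsto _).comp (hω (halfOpenRect m) G)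
  have hGre : Tendsto (fun j => ∑ i, gcGibbsWeightTT' β t t' U μ hz (Ls j) i *
      (torusAvgExpect (Ls j) (halfOpenRect m) G (gcGibbsVectorTT' t t' U μ hz (Ls j) i)).re) atTop
      (𝓝 (ω.expect (halfOpenRect m) G).re) := by
    refine hG'.congr fun j => ?_
    rw [Function.comp_apply, Complex.re_sum]
    exact Finset.sum_congr rfl fun i _ => by rw [Complex.re_ofReal_mul]
  have hlim_rhs : Tendsto (fun j => (#(rectTilingVecs m (Ls j)) : ℝ) / ((Ls j : ℕ) : ℝ) ^ 2 *
        (∑ i, gcGibbsWeightTT' β t t' U μ hz (Ls j) i *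
          (torusAvgExpect (Ls j) (halfOpenRect m) G (gcGibbsVectorTT' t t' U μ hz (Ls j) i)).re + lz) +
      (1 - (#(rectTilingVecs m (Ls j)) : ℝ) / ((Ls j : ℕ) : ℝ) ^ 2 * P) * Real.log 4) atTop
      (𝓝 (1 / P * ((ω.expect (halfOpenRect m) G).re + lz) + (1 - 1 / P * P) * Real.log 4)) :=
    (hN.mul (hGre.add_const lz)).add ((tendsto_const_nhds.sub (hN.mul_const P)).mul_const _)
  have e1 : 1 / P * ((ω.expect (halfOpenRect m) G).re + lz) + (1 - 1 / P * P) * Real.log 4 =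
      ((ω.expect (halfOpenRect m) G).re + lz) / P := by
    field_simp
    ring
  rw [e1] at hlim_rhs
  refine le_of_tendsto_of_tendsto (hΞ.add (hK.const_mul β)) hlim_rhs ?_
  filter_upwards [hLs.eventually_ge_atTop (m 0 + m 1 + 1)] with j hj
  haveI : NeZero (Ls j) := ⟨by omega⟩
  have hmL : ∀ i, m i ≤ Ls j := fun i => by fin_cases i <;> simp <;> omega
  have hL2 : (0 : ℝ) < ((Ls j : ℕ) : ℝ) ^ 2 := by
    have : (1 : ℝ) ≤ ((Ls j : ℕ) : ℝ) := by exact_mod_cast (show 1 ≤ Ls j by omega)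
    positivity
  have hrow := gcGibbs_log_partitionFn_add_energy_le_box (Ls j) β t t' U μ hz hmL hG
  have hL0 : ((Ls j : ℕ) : ℝ) ≠ 0 := by exact_mod_cast (show Ls j ≠ 0 by omega)
  -- rewrite the row divided by `L²`
  simp_rw [torusAvgExpect_eq]
  have e2 : Real.log (partitionFn β (gcTorusHamiltonianTT' (Ls j) t t' U μ hz)).re / ((Ls j : ℕ) : ℝ) ^ 2 +
      β * ∑ i, gcGibbsWeightTT' β t t' U μ hz (Ls j) i *
        ((QuantumLattice.expect (gcTorusHamiltonianTT' (Ls j) t t' U μ hz) (gcGibbsVectorTT' t t' U μ hz (Ls j) i)).re /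
          ((Ls j : ℕ) : ℝ) ^ 2) =
      (Real.log (partitionFn β (gcTorusHamiltonianTT' (Ls j) t t' U μ hz)).re +
        β * ∑ i, gcGibbsWeightTT' β t t' U μ hz (Ls j) i *
          (QuantumLattice.expect (gcTorusHamiltonianTT' (Ls j) t t' U μ hz) (gcGibbsVectorTT' t t' U μ hz (Ls j) i)).re) /
        ((Ls j : ℕ) : ℝ) ^ 2 := by
    rw [add_div, mul_div_assoc, Finset.sum_div]
    congr 2
    exact Finset.sum_congr rfl fun i _ => by ring
  have e3 : (#(rectTilingVecs m (Ls j)) : ℝ) / ((Ls j : ℕ) : ℝ) ^ 2 *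
        (∑ i, gcGibbsWeightTT' β t t' U μ hz (Ls j) i *
          (torusAvgExpectAt (Ls j) (halfOpenRect m) G (gcGibbsVectorTT' t t' U μ hz (Ls j) i)).re + lz) +
      (1 - (#(rectTilingVecs m (Ls j)) : ℝ) / ((Ls j : ℕ) : ℝ) ^ 2 * P) * Real.log 4 =
      ((#(rectTilingVecs m (Ls j)) : ℝ) *
          (∑ i, gcGibbsWeightTT' β t t' U μ hz (Ls j) i *
              (torusAvgExpectAt (Ls j) (halfOpenRect m) G (gcGibbsVectorTT' t t' U μ hz (Ls j) i)).re + lz) +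
        (((Ls j : ℕ) : ℝ) ^ 2 - (#(rectTilingVecs m (Ls j)) : ℝ) * P) * Real.log 4) / ((Ls j : ℕ) : ℝ) ^ 2 := by
    field_simp
  rw [e2, e3]
  exact div_le_div_of_nonneg_right hrow hL2.le

/-- **Zero-field form keyed to `gcPressureTT'`**: `P(β;μ) + β(e_Φ(ω) − μρ(ω)) ≤ (Re ω_B(G) + log Re Tr e^{−G})/|B|`.
[cite: Israel1979, Lemma II.3.1] -/
theorem IsTorusLimitOfMixture.gcPressureTT'_add_mul_energy_le_of_gcGibbs_box
    (hω : ω.IsTorusLimitOfMixture sourcedGibbsCount (gcGibbsWeightTT' β t t' U μ 0)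
      (gcGibbsVectorTT' t t' U μ 0) Ls)
    (hLs : Tendsto Ls atTop atTop) {m : Fin 2 → ℕ} (hm : ∀ i, 0 < m i)
    {G : FermionOp (halfOpenRect m)} (hG : G.IsHermitian) :
    gcPressureTT' β t t' U μ + β * (ω.meanEnergy (hubbardTTPrimeFermionInteraction t t' U) 1 - μ * ω.density) ≤
      ((ω.expect (halfOpenRect m) G).re + Real.log (partitionFn 1 G).re) / ∏ i, (m i : ℝ) := by
  have h := hω.gcPressureTT'Zeeman_add_mul_energy_le_of_gcGibbs_box hβ t t' hU μ 0 hLs hm hG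
  rw [gcPressureTT'Zeeman_zero (β := β) (U := U) t t' μ] at h
  simpa only [zero_mul, sub_zero] using h

end InfVolFermionState

end Literature.MathematicalPhysics.QuantumLattice

end
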